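import Summits.CriticalPhenomena.PercolationContinuityZ3.Theorems.Transplant.FKConnectivityAllQDoubleConeTransfer
import Summits.CriticalPhenomena.PercolationContinuityZ3.Theorems.Transplant.FKConnectivityAllQArborealMonotone
import HarnessLib

/-!
# Connectivity correlation inequalities — the ARBOREAL GAS on the double cone `K_{2,L}`: the exact one-leaf transfer identities for
# `Z_for`, `S(u ↔ v)` and `S(u ↔ v, leaves not isolated)` (weighted spanning forests; no enumeration)

Support file (`--supports stmt-CriticalPhenomena-4575`), census seat `prim-bschramm-census` (gen 21) of the post-continuity
programme; builds on p205010 (kernel theorem, internal audit signed; external expert review pending).  No definitions, no named facts,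
no sorries; standard axioms.  The forest twin of `…AllQDoubleConeTransfer.lean` (same weight vector `FK.DoubleCone.wK u v p L`: parameter
`p` on the pairs `s(u,ℓ)`, `s(ℓ,v)`, `ℓ ∈ L`, `0` elsewhere), for fk-1 g9's arboreal-gas measure `agMeasure` (`…AllQArborealDefs.lean`:
product weight restricted to forest configurations).  Used by `…AllQArborealClusterAssocCex.lean` (which adds `M_insert`, `N_insert` and the kernel refutation of the
forest-CA node `ArborealClusterAssocPos` on `K_{2,74}`, uniform forests).

With `Z(L) = Z_for`, `M(L) = S_L(u ↔ v)`, `N(R, L) = S_L(ev R)` (`S_L(E) = Σ_ω agWeight (wK u v p L) ω · 1_E(ω)`):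
* `Z_empty`, `M_empty`: `Z(∅) = 1`, `M(∅) = 0`;
* **`leaf_elim`** (any event `E`): a leaf `ℓ` is either absent (`(1−p)²`), pendant at one hub (`p(1−p)` each) or carries both pairs
  (`p²`; allowed iff `u ↮ v` before): `S_{L∪ℓ}(E) = (1−p)²S_L(E) + (1−p)p·S_L(E(·∪ℓv)) + p(1−p)·S_L(E(·∪uℓ)) + p²·S_L(1{u↮v}·E(·∪uℓ∪ℓv))`
  — from fk-1 g10's contraction identity `sum_agWeight_setW_true_eq_sum_insert` and the one-point splits `agWeight_mul_ind_mem/_not_mem`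
  (fk-1 g9), with the apex reachability lemmas of `…AllQApexTools`; **`Z_insert`**: `Z(L ∪ {ℓ}) = Z(L) − p²·M(L)`.
[cite: Grimmett2006, §1.5 eq. (1.22) (p. 13); Thm. (3.7) (p. 39)] [cite: AyyerLinussonRavichandran2025, §1 p. 3; §7 Conj. 7.1 (p. 22)]
-/

noncomputable section

namespace Summit.CriticalPhenomena.PercolationContinuityZ3.Theorems

namespace FK

open MeasureTheory Set Literature.Probability.LatticeModels Literature.Probability.Percolation
open Literature.Probability.Percolation.DecisionTree (ind ind_of_mem ind_of_not_mem)
open Literature.Probability.Percolation.BHK2006 (weight)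
open scoped Classical symmDiff

namespace ArborealDoubleCone

open DoubleCone

variable {V : Type*} [Fintype V] (u v : V) (p : unitInterval)

/-! ### Support of the arboreal gas on the double cone -/

/-- A pair of parameter `0` in an arboreal-gas configuration kills the weight. [cite: Grimmett2006, §1.5 eq. (1.22) (p. 13)] -/
theorem agWeight_eq_zero_of_zero_mem (w : Sym2 V → unitInterval) {e : Sym2 V} {ω : BondConfig V} (h0 : (w e : ℝ) = 0) (he : e ∈ ω) :
    agWeight w ω = 0 := by
  by_cases hF : IsForestCfg ω
  · rw [agWeight_of_isForestCfg w hF]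
    unfold weight
    exact Finset.prod_eq_zero (Finset.mem_univ e) (by simp only [if_pos he, h0])
  · exact agWeight_of_not_isForestCfg w hF

/-- Almost surely under the arboreal gas of `K_{2,L}` every present pair is a leaf pair. [cite: Grimmett2006, §1.5 eq. (1.22) (p. 13)] -/
theorem live_of_mem {L : Finset V} {ω : BondConfig V} (hω : agWeight (wK u v p L) ω ≠ 0) {e : Sym2 V} (he : e ∈ ω) :
    ∃ ℓ ∈ L, e = s(u, ℓ) ∨ e = s(ℓ, v) := by
  by_contra hne
  exact hω (agWeight_eq_zero_of_zero_mem (wK u v p L) (wK_eq_zero u v p hne) he)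

/-- Almost surely the present pairs at a vertex `x ∉ {u, v}` go to the hubs (the apex structure of `…AllQApexTools`).
[cite: Grimmett2006, §1.5 eq. (1.22) (p. 13)] -/
theorem apex_of_ne_zero {L : Finset V} {x : V} (hxu : x ≠ u) (hxv : x ≠ v) {ω : BondConfig V}
    (hω : agWeight (wK u v p L) ω ≠ 0) : ∀ e ∈ ω, x ∈ e → e = s(u, x) ∨ e = s(x, v) := by
  intro e he hxe
  obtain ⟨ℓ, -, h | h⟩ := live_of_mem u v p hω he <;> subst h
  · rcases Sym2.mem_iff.1 hxe with h1 | h1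
    · exact (hxu h1).elim
    · subst h1; exact Or.inl rfl
  · rcases Sym2.mem_iff.1 hxe with h1 | h1
    · subst h1; exact Or.inr rfl
    · exact (hxv h1).elim

/-- Almost surely a vertex `ℓ ∉ L` off the hubs is isolated. [cite: Grimmett2006, §1.5 eq. (1.22) (p. 13)] -/
theorem isolated_of_not_mem {L : Finset V} {ℓ : V} (hL : ∀ ℓ' ∈ L, ℓ' ≠ u ∧ ℓ' ≠ v) (huv : u ≠ v) (hℓu : ℓ ≠ u) (hℓv : ℓ ≠ v)
    (hℓ : ℓ ∉ L) {ω : BondConfig V} (hω : agWeight (wK u v p L) ω ≠ 0) : ∀ e ∈ ω, ℓ ∉ e := by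
  intro e he hℓe
  have hd := wK_dead u v p hL huv hℓu hℓ
  rcases apex_of_ne_zero u v p hℓu hℓv hω e he hℓe with rfl | rfl
  · exact hω (agWeight_eq_zero_of_zero_mem _ hd.1 he)
  · exact hω (agWeight_eq_zero_of_zero_mem _ hd.2 he)

/-! ### Masses: bookkeeping -/

/-- Masses of almost surely equal events agree. [cite: Grimmett2006, §1.5 eq. (1.22) (p. 13)] -/
theorem sum_congr_ae (w : Sym2 V → unitInterval) {h₁ h₂ : BondConfig V → ℝ} (h : ∀ ω, agWeight w ω ≠ 0 → h₁ ω = h₂ ω) :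
    ∑ ω : BondConfig V, agWeight w ω * h₁ ω = ∑ ω : BondConfig V, agWeight w ω * h₂ ω := by
  refine Finset.sum_congr rfl fun ω _ => ?_
  by_cases hz : agWeight w ω = 0
  · rw [hz, zero_mul, zero_mul]
  · rw [h ω hz]

/-- `S(Eᶜ) = Z − S(E)`. [cite: Grimmett2006, §1.5 eq. (1.22) (p. 13)] -/
theorem sum_ind_compl (w : Sym2 V → unitInterval) (E : Set (BondConfig V)) :
    ∑ ω : BondConfig V, agWeight w ω * ind Eᶜ ω = agPartition w - ∑ ω : BondConfig V, agWeight w ω * ind E ω := by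
  rw [← sum_agWeight_ind_univ w, ← Finset.sum_sub_distrib]
  refine Finset.sum_congr rfl fun ω _ => ?_
  by_cases h : ω ∈ E
  · rw [ind_of_mem h, ind_of_mem (Set.mem_univ _), ind_of_not_mem (X := Eᶜ) (fun h' => h' h)]; ring
  · rw [ind_of_not_mem h, ind_of_mem (Set.mem_univ _), ind_of_mem (X := Eᶜ) h]; ring

/-- Splitting a mass on the state of one pair. [folklore] -/
theorem sum_split_pair (w : Sym2 V → unitInterval) (P : Sym2 V) (G : BondConfig V → ℝ) :
    ∑ ω : BondConfig V, agWeight w ω * G ω =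
      ∑ ω : BondConfig V, agWeight w ω * (ind {ω : BondConfig V | P ∈ ω}ᶜ ω * G ω) +
        ∑ ω : BondConfig V, agWeight w ω * (ind {ω : BondConfig V | P ∈ ω} ω * G ω) := by
  rw [← Finset.sum_add_distrib]
  refine Finset.sum_congr rfl fun ω _ => ?_
  by_cases hP : P ∈ ω
  · rw [ind_of_mem (X := {ω : BondConfig V | P ∈ ω}) hP, ind_of_not_mem (X := {ω : BondConfig V | P ∈ ω}ᶜ) (fun h => h hP)]
    ring
  · rw [ind_of_not_mem (X := {ω : BondConfig V | P ∈ ω}) hP, ind_of_mem (X := {ω : BondConfig V | P ∈ ω}ᶜ) hP]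
    ring

/-- **Closed-pair split** for the arboreal gas, with an arbitrary integrand: `Σ_ω ag_w(ω)·1{P ∉ ω}·G(ω) = (1 − w P)·Σ_ω ag_{w[P↦0]}(ω)·G(ω)`.
[cite: Grimmett2006, Thm. (3.7) (p. 39)] -/
theorem sum_closed (w : Sym2 V → unitInterval) (P : Sym2 V) (G : BondConfig V → ℝ) :
    ∑ ω : BondConfig V, agWeight w ω * (ind {ω : BondConfig V | P ∈ ω}ᶜ ω * G ω) =
      (1 - ((w P : unitInterval) : ℝ)) * ∑ ω : BondConfig V, agWeight (Function.update w P 0) ω * G ω := by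
  rw [Finset.mul_sum]
  refine Finset.sum_congr rfl fun ω _ => ?_
  have key := agWeight_mul_ind_not_mem w P ω
  have hset : setW w P false = Function.update w P 0 := by simp [setW]
  have hc : ({ω : BondConfig V | P ∈ ω}ᶜ : Set (BondConfig V)) = {ω : BondConfig V | P ∉ ω} := by ext; simp
  rw [hset] at key
  rw [← mul_assoc, hc, key, mul_assoc]

/-- **Open-pair split (contraction)** for the arboreal gas, with an arbitrary integrand:
`Σ_ω ag_w(ω)·1{P ∈ ω}·G(ω) = (w P)·Σ_ω ag_{w[P↦0]}(ω)·1{x ↮ y}(ω)·G(ω ∪ {P})` (`P = s(x,y)`, `x ≠ y`).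
[cite: Grimmett2006, Thm. (3.7) (p. 39); §1.5 eq. (1.22) (p. 13)] -/
theorem sum_open (w : Sym2 V → unitInterval) {x y : V} (hxy : x ≠ y) (G : BondConfig V → ℝ) :
    ∑ ω : BondConfig V, agWeight w ω * (ind {ω : BondConfig V | s(x, y) ∈ ω} ω * G ω) =
      ((w s(x, y) : unitInterval) : ℝ) * ∑ ω : BondConfig V, agWeight (Function.update w s(x, y) 0) ω *
        (ind (openConn x y : Set (BondConfig V))ᶜ ω * G (insert s(x, y) ω)) := by
  have hset0 : setW w s(x, y) false = Function.update w s(x, y) 0 := by simp [setW]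
  have h1 : ∑ ω : BondConfig V, agWeight w ω * (ind {ω : BondConfig V | s(x, y) ∈ ω} ω * G ω) =
      ((w s(x, y) : unitInterval) : ℝ) * ∑ ω : BondConfig V, agWeight (setW w s(x, y) true) ω * G ω := by
    rw [Finset.mul_sum]
    refine Finset.sum_congr rfl fun ω _ => ?_
    rw [← mul_assoc, agWeight_mul_ind_mem w s(x, y) ω, mul_assoc]
  rw [h1, sum_agWeight_setW_true_eq_sum_insert w hxy G, hset0]

/-! ### The empty double cone -/

/-- `Z_for(∅) = 1`: with every pair dead only the empty forest carries weight. [cite: Grimmett2006, §1.5 eq. (1.22) (p. 13)] -/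
theorem Z_empty : agPartition (wK u v p (∅ : Finset V)) = 1 := by
  have h0 : ∀ e : Sym2 V, ((wK u v p ∅ e : unitInterval) : ℝ) = 0 := fun e => wK_eq_zero u v p (by simp)
  unfold agPartition
  rw [Finset.sum_eq_single (∅ : BondConfig V)]
  · rw [agWeight_of_isForestCfg _ isForestCfg_empty]
    unfold weight
    simp [h0]
  · intro ω _ hne
    obtain ⟨e, he⟩ := Set.nonempty_iff_ne_empty.2 hne
    exact agWeight_eq_zero_of_zero_mem _ (h0 e) he
  · intro h; exact (h (Finset.mem_univ _)).elim

/-- `M(∅) = 0`. [cite: Grimmett2006, §1.5 eq. (1.22) (p. 13)] -/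
theorem M_empty (huv : u ≠ v) :
    ∑ ω : BondConfig V, agWeight (wK u v p (∅ : Finset V)) ω * ind (openConn u v : Set (BondConfig V)) ω = 0 := by
  refine Finset.sum_eq_zero fun ω _ => ?_
  by_cases hz : agWeight (wK u v p ∅) ω = 0
  · rw [hz, zero_mul]
  have hiso : ∀ e ∈ ω, u ∉ e := by
    intro e he _
    obtain ⟨ℓ, hℓ, _⟩ := live_of_mem u v p hz he
    simp at hℓ
  rw [ind_of_not_mem (X := (openConn u v : Set (BondConfig V)))
    (fun h => not_reachable_of_isolated hiso huv.symm ((mem_openConn_iff' u v ω).1 h)), mul_zero]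

/-! ### One transfer step: removing a leaf -/

section Step

variable {u v p} {L : Finset V} {ℓ : V}

omit [Fintype V] in
/-- Adding apex pairs to a configuration in which the apex `ℓ` is isolated: `u ↔ v` afterwards iff `u ↔ v` before or both pairs were
added. [folklore] -/
theorem reachable_union_apex (hℓu : ℓ ≠ u) (hℓv : ℓ ≠ v) {ω : BondConfig V} (hisoω : ∀ e ∈ ω, ℓ ∉ e) {τ : Set (Sym2 V)}
    (hτ : τ ⊆ {s(u, ℓ), s(ℓ, v)}) :
    (openGraph (τ ∪ ω)).Reachable u v ↔ (openGraph ω).Reachable u v ∨ (s(u, ℓ) ∈ τ ∧ s(ℓ, v) ∈ τ) := by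
  have haω : s(u, ℓ) ∉ ω := fun h => hisoω _ h (Sym2.mem_mk_right u ℓ)
  have hbω : s(ℓ, v) ∉ ω := fun h => hisoω _ h (Sym2.mem_mk_left ℓ v)
  have hapex : ∀ e ∈ τ ∪ ω, ℓ ∈ e → e = s(u, ℓ) ∨ e = s(ℓ, v) := by
    rintro e (he | he) hℓe
    · rcases hτ he with h | h
      · exact Or.inl h
      · exact Or.inr h
    · exact (hisoω e he hℓe).elim
  have hdiff : (τ ∪ ω) \ {s(u, ℓ), s(ℓ, v)} = ω := by
    ext e
    simp only [Set.mem_sdiff, Set.mem_union, Set.mem_insert_iff, Set.mem_singleton_iff]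
    constructor
    · rintro ⟨he | he, hne⟩
      · rcases hτ he with h | h
        · exact (hne (Or.inl h)).elim
        · exact (hne (Or.inr h)).elim
      · exact he
    · intro he
      refine ⟨Or.inr he, ?_⟩
      rintro (rfl | rfl)
      · exact haω he
      · exact hbω he
  rw [reachable_uv_apex_iff hℓu hℓv hapex, hdiff]
  simp only [Set.mem_union, haω, hbω, or_false]

omit [Fintype V] in
/-- With `ℓ` isolated: `u ↔ ℓ` after adding the pair `ℓv` iff `u ↔ v` before. [folklore] -/
theorem reachable_uℓ_insert_b (huv : u ≠ v) (hℓu : ℓ ≠ u) (hℓv : ℓ ≠ v) {ω : BondConfig V} (hisoω : ∀ e ∈ ω, ℓ ∉ e) :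
    (openGraph (insert s(ℓ, v) ω)).Reachable u ℓ ↔ (openGraph ω).Reachable u v := by
  have hab : s(u, ℓ) ≠ s(ℓ, v) := apex_pairs_ne hℓu huv
  have haω : s(u, ℓ) ∉ ω := fun h => hisoω _ h (Sym2.mem_mk_right u ℓ)
  have hbω : s(ℓ, v) ∉ ω := fun h => hisoω _ h (Sym2.mem_mk_left ℓ v)
  have ha : s(u, ℓ) ∉ insert s(ℓ, v) ω := by
    rintro (h | h)
    · exact hab h
    · exact haω h
  have hapex : ∀ e ∈ insert s(ℓ, v) ω, ℓ ∈ e → e = s(u, ℓ) ∨ e = s(ℓ, v) := by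
    rintro e (rfl | he) hℓe
    · exact Or.inr rfl
    · exact (hisoω e he hℓe).elim
  have hdiff : insert s(ℓ, v) ω \ {s(u, ℓ), s(ℓ, v)} = ω := by
    ext e
    simp only [Set.mem_sdiff, Set.mem_insert_iff, Set.mem_singleton_iff]
    constructor
    · rintro ⟨rfl | he, hne⟩
      · exact (hne (Or.inr rfl)).elim
      · exact he
    · intro he
      refine ⟨Or.inr he, ?_⟩
      rintro (rfl | rfl)
      · exact haω he
      · exact hbω he
  rw [reachable_ux_apex_iff hℓu hℓv hapex, hdiff]
  simp only [ha, false_or, Set.mem_insert_iff, true_or, true_and]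

variable (hL : ∀ ℓ' ∈ L, ℓ' ≠ u ∧ ℓ' ≠ v) (huv : u ≠ v) (hℓu : ℓ ≠ u) (hℓv : ℓ ≠ v) (hℓ : ℓ ∉ L)
include hL huv hℓu hℓv hℓ

/-- **Leaf elimination for the arboreal gas**: for any event `E`,
`S_{L∪ℓ}(E) = (1−p)²·S_L(E) + (1−p)p·S_L(E ∘ (· ∪ {ℓv})) + p(1−p)·S_L(E ∘ (· ∪ {uℓ})) + p²·S_L({u ↮ v} ∩ E ∘ (· ∪ {uℓ, ℓv}))`.
[cite: Grimmett2006, §1.5 eq. (1.22) (p. 13); Thm. (3.7) (p. 39)] -/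
theorem leaf_elim (E : Set (BondConfig V)) :
    ∑ ω : BondConfig V, agWeight (wK u v p (insert ℓ L)) ω * ind E ω =
      (1 - (p : ℝ)) * (1 - (p : ℝ)) * ∑ ω : BondConfig V, agWeight (wK u v p L) ω * ind E ω +
      (1 - (p : ℝ)) * (p : ℝ) * ∑ ω : BondConfig V, agWeight (wK u v p L) ω * ind E (insert s(ℓ, v) ω) +
      (p : ℝ) * (1 - (p : ℝ)) * ∑ ω : BondConfig V, agWeight (wK u v p L) ω * ind E (insert s(u, ℓ) ω) +
      (p : ℝ) * (p : ℝ) * ∑ ω : BondConfig V, agWeight (wK u v p L) ω *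
        (ind (openConn u v : Set (BondConfig V))ᶜ ω * ind E (insert s(u, ℓ) (insert s(ℓ, v) ω))) := by
  set w := wK u v p (insert ℓ L) with hw
  have hwa : ((w s(u, ℓ) : unitInterval) : ℝ) = p := wK_apply_left u v p (Finset.mem_insert_self ℓ L)
  have hwb : ((w s(ℓ, v) : unitInterval) : ℝ) = p := wK_apply_right u v p (Finset.mem_insert_self ℓ L)
  have hab : s(u, ℓ) ≠ s(ℓ, v) := apex_pairs_ne hℓu huv
  have hup := wK_insert_update u v p hL huv hℓu hℓv hℓ
  have hupb : Function.update (Function.update w s(ℓ, v) 0) s(u, ℓ) 0 = wK u v p L := by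
    rw [Function.update_comm hab.symm, hup]
  have hw₁b : ((Function.update w s(u, ℓ) 0 s(ℓ, v) : unitInterval) : ℝ) = p := by
    rw [Function.update_of_ne hab.symm, hwb]
  have hw₂a : ((Function.update w s(ℓ, v) 0 s(u, ℓ) : unitInterval) : ℝ) = p := by
    rw [Function.update_of_ne hab, hwa]
  -- a.s. under `wK L`: `ℓ` is isolated
  have hiso : ∀ ω, agWeight (wK u v p L) ω ≠ 0 → ∀ e ∈ ω, ℓ ∉ e := fun ω hω =>
    isolated_of_not_mem u v p hL huv hℓu hℓv hℓ hω
  -- the four corners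
  have T00 : ∑ ω : BondConfig V, agWeight w ω *
      (ind {ω : BondConfig V | s(u, ℓ) ∈ ω}ᶜ ω * (ind {ω : BondConfig V | s(ℓ, v) ∈ ω}ᶜ ω * ind E ω)) =
      (1 - (p : ℝ)) * ((1 - (p : ℝ)) * ∑ ω : BondConfig V, agWeight (wK u v p L) ω * ind E ω) := by
    rw [sum_closed w s(u, ℓ), hwa, sum_closed _ s(ℓ, v), hw₁b, hup]
  have T01 : ∑ ω : BondConfig V, agWeight w ω *
      (ind {ω : BondConfig V | s(u, ℓ) ∈ ω}ᶜ ω * (ind {ω : BondConfig V | s(ℓ, v) ∈ ω} ω * ind E ω)) =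
      (1 - (p : ℝ)) * ((p : ℝ) * ∑ ω : BondConfig V, agWeight (wK u v p L) ω * ind E (insert s(ℓ, v) ω)) := by
    have hx : ∑ ω : BondConfig V, agWeight (wK u v p L) ω *
        (ind (openConn ℓ v : Set (BondConfig V))ᶜ ω * ind E (insert s(ℓ, v) ω)) =
        ∑ ω : BondConfig V, agWeight (wK u v p L) ω * ind E (insert s(ℓ, v) ω) := by
      refine sum_congr_ae (wK u v p L) fun ω hω => ?_
      have hnr : ω ∈ (openConn ℓ v : Set (BondConfig V))ᶜ := fun h =>
        not_reachable_of_isolated (hiso ω hω) hℓv.symm ((mem_openConn_iff' ℓ v ω).1 h)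
      rw [ind_of_mem hnr, one_mul]
    rw [sum_closed w s(u, ℓ), hwa, sum_open _ hℓv, hw₁b, hup, hx]
  have T10 : ∑ ω : BondConfig V, agWeight w ω *
      (ind {ω : BondConfig V | s(u, ℓ) ∈ ω} ω * (ind {ω : BondConfig V | s(ℓ, v) ∈ ω}ᶜ ω * ind E ω)) =
      (1 - (p : ℝ)) * ((p : ℝ) * ∑ ω : BondConfig V, agWeight (wK u v p L) ω * ind E (insert s(u, ℓ) ω)) := by
    have hre : ∑ ω : BondConfig V, agWeight w ω *
        (ind {ω : BondConfig V | s(u, ℓ) ∈ ω} ω * (ind {ω : BondConfig V | s(ℓ, v) ∈ ω}ᶜ ω * ind E ω)) =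
        ∑ ω : BondConfig V, agWeight w ω *
          (ind {ω : BondConfig V | s(ℓ, v) ∈ ω}ᶜ ω * (ind {ω : BondConfig V | s(u, ℓ) ∈ ω} ω * ind E ω)) :=
      Finset.sum_congr rfl fun ω _ => by ring
    have hx : ∑ ω : BondConfig V, agWeight (wK u v p L) ω *
        (ind (openConn u ℓ : Set (BondConfig V))ᶜ ω * ind E (insert s(u, ℓ) ω)) =
        ∑ ω : BondConfig V, agWeight (wK u v p L) ω * ind E (insert s(u, ℓ) ω) := by
      refine sum_congr_ae (wK u v p L) fun ω hω => ?_
      have hnr : ω ∈ (openConn u ℓ : Set (BondConfig V))ᶜ := fun h =>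
        not_reachable_of_isolated' (hiso ω hω) hℓu.symm ((mem_openConn_iff' u ℓ ω).1 h)
      rw [ind_of_mem hnr, one_mul]
    rw [hre, sum_closed w s(ℓ, v), hwb, sum_open _ hℓu.symm, hw₂a, hupb, hx]
  have T11 : ∑ ω : BondConfig V, agWeight w ω *
      (ind {ω : BondConfig V | s(u, ℓ) ∈ ω} ω * (ind {ω : BondConfig V | s(ℓ, v) ∈ ω} ω * ind E ω)) =
      (p : ℝ) * ((p : ℝ) * ∑ ω : BondConfig V, agWeight (wK u v p L) ω *
        (ind (openConn u v : Set (BondConfig V))ᶜ ω * ind E (insert s(u, ℓ) (insert s(ℓ, v) ω)))) := by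
    rw [sum_open w hℓu.symm, hwa]
    -- reorder the integrand to expose `1{b ∈ ω}` (note `b ∈ ω ∪ {a} ↔ b ∈ ω`)
    have hre : ∑ ω : BondConfig V, agWeight (Function.update w s(u, ℓ) 0) ω *
        (ind (openConn u ℓ : Set (BondConfig V))ᶜ ω *
          (ind {ω : BondConfig V | s(ℓ, v) ∈ ω} (insert s(u, ℓ) ω) * ind E (insert s(u, ℓ) ω))) =
        ∑ ω : BondConfig V, agWeight (Function.update w s(u, ℓ) 0) ω *
          (ind {ω : BondConfig V | s(ℓ, v) ∈ ω} ω *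
            (ind (openConn u ℓ : Set (BondConfig V))ᶜ ω * ind E (insert s(u, ℓ) ω))) := by
      refine Finset.sum_congr rfl fun ω _ => ?_
      have hb : ind {ω : BondConfig V | s(ℓ, v) ∈ ω} (insert s(u, ℓ) ω) = ind {ω : BondConfig V | s(ℓ, v) ∈ ω} ω := by
        by_cases h : s(ℓ, v) ∈ ω
        · have h' : insert s(u, ℓ) ω ∈ {ω : BondConfig V | s(ℓ, v) ∈ ω} := Set.mem_insert_of_mem _ h
          rw [ind_of_mem (X := {ω : BondConfig V | s(ℓ, v) ∈ ω}) h, ind_of_mem h']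
        · have h' : insert s(u, ℓ) ω ∉ {ω : BondConfig V | s(ℓ, v) ∈ ω} := by
            rintro (h' | h')
            · exact hab.symm h'
            · exact h h'
          rw [ind_of_not_mem (X := {ω : BondConfig V | s(ℓ, v) ∈ ω}) h, ind_of_not_mem h']
      rw [hb]; ring
    have hx : ∑ ω : BondConfig V, agWeight (wK u v p L) ω *
        (ind (openConn ℓ v : Set (BondConfig V))ᶜ ω *
          (ind (openConn u ℓ : Set (BondConfig V))ᶜ (insert s(ℓ, v) ω) * ind E (insert s(u, ℓ) (insert s(ℓ, v) ω)))) =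
        ∑ ω : BondConfig V, agWeight (wK u v p L) ω *
          (ind (openConn u v : Set (BondConfig V))ᶜ ω * ind E (insert s(u, ℓ) (insert s(ℓ, v) ω))) := by
      refine sum_congr_ae (wK u v p L) fun ω hω => ?_
      have hisoω := hiso ω hω
      have hnr : ω ∈ (openConn ℓ v : Set (BondConfig V))ᶜ := fun h =>
        not_reachable_of_isolated hisoω hℓv.symm ((mem_openConn_iff' ℓ v ω).1 h)
      have hiff : insert s(ℓ, v) ω ∈ (openConn u ℓ : Set (BondConfig V))ᶜ ↔ ω ∈ (openConn u v : Set (BondConfig V))ᶜ := by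
        rw [Set.mem_compl_iff, Set.mem_compl_iff, mem_openConn_iff', mem_openConn_iff', reachable_uℓ_insert_b huv hℓu hℓv hisoω]
      rw [ind_of_mem hnr, one_mul]
      by_cases h1 : ω ∈ (openConn u v : Set (BondConfig V))ᶜ
      · rw [ind_of_mem h1, ind_of_mem (hiff.2 h1)]
      · rw [ind_of_not_mem h1, ind_of_not_mem (fun h => h1 (hiff.1 h))]
    rw [hre, sum_open _ hℓv, hw₁b, hup, hx]
  rw [sum_split_pair w s(ℓ, v) (ind E), sum_split_pair w s(u, ℓ) (fun ω => ind {ω : BondConfig V | s(ℓ, v) ∈ ω}ᶜ ω * ind E ω),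
    sum_split_pair w s(u, ℓ) (fun ω => ind {ω : BondConfig V | s(ℓ, v) ∈ ω} ω * ind E ω), T00, T01, T10, T11]
  ring

/-- `Z(L ∪ {ℓ}) = Z(L) − p²·M(L)`. [cite: Grimmett2006, §1.5 eq. (1.22) (p. 13); Thm. (3.7) (p. 39)] -/
theorem Z_insert :
    agPartition (wK u v p (insert ℓ L)) =
      agPartition (wK u v p L) - (p : ℝ) * (p : ℝ) *
        ∑ ω : BondConfig V, agWeight (wK u v p L) ω * ind (openConn u v : Set (BondConfig V)) ω := by
  have key := leaf_elim (p := p) hL huv hℓu hℓv hℓ (Set.univ : Set (BondConfig V))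
  rw [sum_agWeight_ind_univ, sum_agWeight_ind_univ] at key
  simp only [ind_of_mem (Set.mem_univ _), mul_one] at key
  have hZ' : ∑ x : BondConfig V, agWeight (wK u v p L) x = agPartition (wK u v p L) := rfl
  rw [key, hZ', sum_ind_compl]
  ring

end Step

end ArborealDoubleCone

end FK

end Summit.CriticalPhenomena.PercolationContinuityZ3.Theorems

end
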